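import Literature.Probability.LatticeModels.IsingLaceFirstPivotal
import HarnessLib

/-!
# Sakai's first expansion, step (2.12)–(2.13): the parity of the pivotal bond and the `tanh` flip

Topic `Probability/LatticeModels`, grouping namespace `IsingLace`. Second file of the proof
campaign for Sakai 2007, Proposition 1.1 (`IsingLace.Sakai2007_prop11`): in the summand of the
first-pivotal-bond decomposition (2.9)/(2.11),
`Σ_{∂n = o△x} w(n) 1{o ⟺_n b̲ off b} 1{n_b > 0} 1{b̄ ⟷_n x in 𝒞^b_n(o)ᶜ}`,
"since `b` is pivotal … and `∂n = o△x`, in fact `n_b` is an odd integer. We alternate the parity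
of `n_b` by changing the source constraint into `o △ b △ x` and multiplying by
`Σ_{n odd}(pJ_b)^n/n! / Σ_{n even}(pJ_b)^n/n! = tanh(pJ_b) ≡ τ_b`" (Sakai 2007, (2.12)–(2.13)).

Proved here, for a finite graph with uniform coupling `β ≥ 0` (all current sums in `ℝ≥0∞`, as in
`WeightedCurrents.lean`):
* the one-bond factorisation of the weight `w(n) = β^{n_b}/n_b! · w(n|_{n_b=0})`
  (`weight_eq_mul_weight_update`) and of the sources
  `∂n = ∂(n|_{n_b=0}) △ 1{n_b odd}{b̲, b̄}` (`sources_eq_symmDiff_update`);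
* Fubini in the coordinate `b` (`tsum_eq_tsum_tsum_split`); the parity series
  `Σ_{k odd} β^k/k! = sinh β`, `Σ_{k even} β^k/k! = cosh β` in `ℝ≥0∞` are
  `tsum_edgeWeight_odd` / `tsum_edgeWeight_even` of `ModifiedSimonInequality.lean`
  (summand `edgeWeight β k = ENNReal.ofReal (β ^ k / k!)`);
* **the `tanh` flip** (`tsum_odd_eq_tanh_mul_tsum_even`): for every `F ≥ 0` blind to `n_b` and
  every source set `A`,
  `Σ_{∂n = A, n_b odd} w(n) F(n) = tanh β · Σ_{∂n = A △ {b̲,b̄}, n_b even} w(n) F(n)`;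
* **the parity lemma** (`odd_of_isFirstPivotal`): on `{∂n = o△x}` a qualifying bond of (2.9)
  carries an ODD current (handshake on the cluster `𝒞^b_n(o)`, which contains `o` but not `x`),
  and the resulting form (2.13) of the `b`-summand (`tsum_isFirstPivotal_eq`).

## References

* A. Sakai, *Lace expansion for the Ising model*, Comm. Math. Phys. 272 (2007) 283–344,
  arXiv:math-ph/0510093, §2.2.1, (2.11)–(2.13) [Sakai2007].
-/

noncomputable section

open Finset
open scoped symmDiff ENNReal BigOperators

namespace Literature.Probability.LatticeModels

variable {V : Type*} [Fintype V] [DecidableEq V] {G : SimpleGraph V} [DecidableRel G.Adj]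

namespace IsingLace

/-! ## One-bond factorisation of weights and sources -/

/-- `w(n) = β^{n_b}/n_b! · w(n|_{n_b = 0})`. [cite: Sakai2007, (2.12)] -/
theorem weight_eq_mul_weight_update (β : ℝ) (n : Current G) (b : G.edgeFinset) :
    Current.weight β n = β ^ (n b) / ((n b).factorial : ℝ) * Current.weight β (Function.update n b 0) := by
  unfold Current.weight
  rw [Fintype.prod_eq_mul_prod_subtype_ne _ b, Fintype.prod_eq_mul_prod_subtype_ne _ b,
    Function.update_self, pow_zero, Nat.factorial_zero, Nat.cast_one, div_one, one_mul]
  congr 1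
  refine Fintype.prod_congr _ _ fun e => ?_
  rw [Function.update_of_ne e.2]

/-- The degree at `w` changes by `n_b 1{w ∈ b}` when `n_b` is reset. [folklore] -/
theorem degree_eq_degree_update_add (n : Current G) (b : G.edgeFinset) (w : V) :
    Current.degree n w = Current.degree (Function.update n b 0 : Current G) w +
      (if w ∈ (b : Sym2 V) then n b else 0) := by
  unfold Current.degree
  rw [Fintype.sum_eq_add_sum_subtype_ne _ b, Fintype.sum_eq_add_sum_subtype_ne _ b,
    Function.update_self]
  have : ∑ i : {i // i ≠ b}, (if w ∈ ((i.1 : G.edgeFinset) : Sym2 V) then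
      (Function.update n b 0 : G.edgeFinset → ℕ) i.1 else 0) =
      ∑ i : {i // i ≠ b}, (if w ∈ ((i.1 : G.edgeFinset) : Sym2 V) then n i.1 else 0) :=
    Fintype.sum_congr _ _ fun i => by rw [Function.update_of_ne i.2]
  rw [this]
  split_ifs <;> simp [add_comm]

/-- **Sources after resetting one bond**: `∂n = ∂(n|_{n_b=0}) △ 1{n_b odd}({b̲} △ {b̄})`.
[cite: Sakai2007, (2.12)–(2.13) (alternating the parity of n_b changes the source constraint by b)] -/
theorem sources_eq_symmDiff_update (n : Current G) (b : G.edgeFinset) {u v : V}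
    (hb : (b : Sym2 V) = s(u, v)) :
    Current.sources n = Current.sources (Function.update n b 0 : Current G) ∆
      (if Odd (n b) then ({u} : Finset V) ∆ {v} else ∅) := by
  have huv : u ≠ v := by
    intro h
    have := G.ne_of_adj (SimpleGraph.mem_edgeFinset.1 (hb ▸ b.2))
    exact this h
  ext w
  simp only [Current.mem_sources_iff, Finset.mem_symmDiff]
  rw [degree_eq_degree_update_add n b w, hb]
  by_cases hw : w ∈ (s(u, v) : Sym2 V)
  · rw [if_pos hw, Nat.odd_add, ← Nat.not_odd_iff_even]
    have hwuv : w ∈ (if Odd (n b) then ({u} : Finset V) ∆ {v} else ∅) ↔ Odd (n b) := by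
      split_ifs with ho
      · simp only [Finset.mem_symmDiff, Finset.mem_singleton]
        rw [Sym2.mem_iff] at hw
        rcases hw with rfl | rfl
        · simp [huv, ho]
        · simp [Ne.symm huv, ho]
      · simp [ho]
    rw [hwuv]
    tauto
  · rw [if_neg hw, add_zero]
    have hwuv : w ∉ (if Odd (n b) then ({u} : Finset V) ∆ {v} else ∅) := by
      split_ifs
      · simp only [Finset.mem_symmDiff, Finset.mem_singleton]
        rw [Sym2.mem_iff] at hw
        push Not at hw
        simp [hw.1, hw.2]
      · simp
    tauto

/-! ## Fubini in one bond -/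

/-- The current obtained from the split coordinates `(k, r)` at the bond `b`. [folklore] -/
theorem funSplitAt_symm_apply_self (b : G.edgeFinset) (p : ℕ × ({j : G.edgeFinset // j ≠ b} → ℕ)) :
    ((Equiv.funSplitAt b ℕ).symm p : Current G) b = p.1 := by
  simp [Equiv.funSplitAt, Equiv.piSplitAt]

/-- Resetting the split coordinate. [folklore] -/
theorem update_funSplitAt_symm (b : G.edgeFinset) (k : ℕ) (r : {j : G.edgeFinset // j ≠ b} → ℕ) :
    (Function.update ((Equiv.funSplitAt b ℕ).symm (k, r) : Current G) b 0) =
      (Equiv.funSplitAt b ℕ).symm (0, r) := by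
  funext e
  by_cases he : e = b
  · subst he
    rw [Function.update_self, funSplitAt_symm_apply_self]
  · rw [Function.update_of_ne he]
    simp [Equiv.funSplitAt, Equiv.piSplitAt, he]

/-- **Fubini in the coordinate `b`** for nonnegative functions of currents. [folklore] -/
theorem tsum_eq_tsum_tsum_split (b : G.edgeFinset) (f : Current G → ℝ≥0∞) :
    ∑' n : Current G, f n =
      ∑' r : {j : G.edgeFinset // j ≠ b} → ℕ, ∑' k : ℕ, f ((Equiv.funSplitAt b ℕ).symm (k, r)) := by
  rw [← Equiv.tsum_eq (Equiv.funSplitAt b ℕ).symm, ENNReal.tsum_prod', ENNReal.tsum_comm]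

/-! ## The `tanh` flip -/

/-- **The `tanh` flip** ((2.12)–(2.13)): for `β ≥ 0`, a bond `b = s(u, v)`, a source set `A` and
a nonnegative function `F` of the current blind to `n_b`,
`Σ_{∂n = A, n_b odd} w(n) F(n) = tanh β · Σ_{∂n = A △ ({u} △ {v}), n_b even} w(n) F(n)`
(both equal `sinh β · Σ_{n_b = 0, ∂n △ {u}△{v} = A} w(n)F(n)`). [cite: Sakai2007, (2.12)–(2.13)] -/
theorem tsum_odd_eq_tanh_mul_tsum_even {β : ℝ} (hβ : 0 ≤ β) (b : G.edgeFinset) {u v : V}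
    (hb : (b : Sym2 V) = s(u, v)) (A : Finset V) (F : Current G → ℝ≥0∞)
    (hF : ∀ n : Current G, F n = F (Function.update n b 0)) :
    ∑' n : Current G, (if Current.sources n = A ∧ Odd (n b) then
        ENNReal.ofReal (Current.weight β n) * F n else 0) =
      ENNReal.ofReal (Real.tanh β) * ∑' n : Current G,
        (if Current.sources n = A ∆ ({u} ∆ {v}) ∧ Even (n b) then
          ENNReal.ofReal (Current.weight β n) * F n else 0) := by
  classical
  set Ψ := (Equiv.funSplitAt b ℕ).symm with hΨ
  -- the common value `S = Σ_r [∂n₀ △ uv = A] w(n₀) F(n₀)` over currents with `n_b = 0`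
  set S : ℝ≥0∞ := ∑' r : {j : G.edgeFinset // j ≠ b} → ℕ,
    (if Current.sources (Ψ (0, r)) ∆ ({u} ∆ {v}) = A then
      ENNReal.ofReal (Current.weight β (Ψ (0, r))) * F (Ψ (0, r)) else 0) with hS
  -- pointwise factorisation of the summands
  have hfac : ∀ (k : ℕ) (r : {j : G.edgeFinset // j ≠ b} → ℕ),
      ENNReal.ofReal (Current.weight β (Ψ (k, r))) * F (Ψ (k, r)) =
        edgeWeight β k * (ENNReal.ofReal (Current.weight β (Ψ (0, r))) * F (Ψ (0, r))) := by
    intro k r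
    rw [edgeWeight, weight_eq_mul_weight_update β (Ψ (k, r)) b, hF (Ψ (k, r)),
      update_funSplitAt_symm, funSplitAt_symm_apply_self, ENNReal.ofReal_mul (by positivity),
      mul_assoc]
  have hkb : ∀ (k : ℕ) (r : {j : G.edgeFinset // j ≠ b} → ℕ), (Ψ (k, r)) b = k := fun k r =>
    funSplitAt_symm_apply_self b (k, r)
  have hsrc : ∀ (k : ℕ) (r : {j : G.edgeFinset // j ≠ b} → ℕ),
      Current.sources (Ψ (k, r)) =
        Current.sources (Ψ (0, r)) ∆ (if Odd k then ({u} : Finset V) ∆ {v} else ∅) := by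
    intro k r
    rw [sources_eq_symmDiff_update (Ψ (k, r)) b hb, update_funSplitAt_symm, funSplitAt_symm_apply_self]
  have hempty : ∀ s : Finset V, s ∆ ∅ = s := fun s => by
    rw [← Finset.bot_eq_empty]; exact symmDiff_bot s
  have hAeq : ∀ r : {j : G.edgeFinset // j ≠ b} → ℕ,
      Current.sources (Ψ (0, r)) = A ∆ ({u} ∆ {v}) ↔ Current.sources (Ψ (0, r)) ∆ ({u} ∆ {v}) = A := by
    intro r
    constructor
    · intro h; rw [h, symmDiff_assoc, symmDiff_self, symmDiff_bot]
    · intro h; rw [← h, symmDiff_assoc, symmDiff_self, symmDiff_bot]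
  -- left-hand side
  have hL : ∑' n : Current G, (if Current.sources n = A ∧ Odd (n b) then
      ENNReal.ofReal (Current.weight β n) * F n else 0) = S * ENNReal.ofReal (Real.sinh β) := by
    rw [tsum_eq_tsum_tsum_split b, hS, ← ENNReal.tsum_mul_right]
    refine tsum_congr fun r => ?_
    rw [← tsum_edgeWeight_odd hβ, ← ENNReal.tsum_mul_left]
    refine tsum_congr fun k => ?_
    change (if Current.sources (Ψ (k, r)) = A ∧ Odd ((Ψ (k, r)) b) then
        ENNReal.ofReal (Current.weight β (Ψ (k, r))) * F (Ψ (k, r)) else 0) = _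
    by_cases hk : Odd k
    · by_cases hA : Current.sources (Ψ (0, r)) ∆ ({u} ∆ {v}) = A
      · have hc : Current.sources (Ψ (k, r)) = A ∧ Odd ((Ψ (k, r)) b) := by
          rw [hsrc, if_pos hk, hkb]; exact ⟨hA, hk⟩
        rw [if_pos hc, if_pos hA, if_pos hk, hfac, mul_comm]
      · have hc : ¬(Current.sources (Ψ (k, r)) = A ∧ Odd ((Ψ (k, r)) b)) := by
          rw [hsrc, if_pos hk]; exact fun h => hA h.1
        rw [if_neg hc, if_neg hA, zero_mul]
    · have hc : ¬(Current.sources (Ψ (k, r)) = A ∧ Odd ((Ψ (k, r)) b)) := by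
        rw [hkb]; exact fun h => hk h.2
      rw [if_neg hc, if_neg hk, mul_zero]
  -- right-hand side
  have hR : ∑' n : Current G, (if Current.sources n = A ∆ ({u} ∆ {v}) ∧ Even (n b) then
      ENNReal.ofReal (Current.weight β n) * F n else 0) = S * ENNReal.ofReal (Real.cosh β) := by
    rw [tsum_eq_tsum_tsum_split b, hS, ← ENNReal.tsum_mul_right]
    refine tsum_congr fun r => ?_
    rw [← tsum_edgeWeight_even hβ, ← ENNReal.tsum_mul_left]
    refine tsum_congr fun k => ?_
    change (if Current.sources (Ψ (k, r)) = A ∆ ({u} ∆ {v}) ∧ Even ((Ψ (k, r)) b) then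
        ENNReal.ofReal (Current.weight β (Ψ (k, r))) * F (Ψ (k, r)) else 0) = _
    by_cases hk : Even k
    · have hko : ¬Odd k := Nat.not_odd_iff_even.2 hk
      by_cases hA : Current.sources (Ψ (0, r)) ∆ ({u} ∆ {v}) = A
      · have hc : Current.sources (Ψ (k, r)) = A ∆ ({u} ∆ {v}) ∧ Even ((Ψ (k, r)) b) := by
          rw [hsrc, if_neg hko, hempty, hkb]; exact ⟨(hAeq r).2 hA, hk⟩
        rw [if_pos hc, if_pos hA, if_pos hk, hfac, mul_comm]
      · have hc : ¬(Current.sources (Ψ (k, r)) = A ∆ ({u} ∆ {v}) ∧ Even ((Ψ (k, r)) b)) := by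
          rw [hsrc, if_neg hko, hempty]; exact fun h => hA ((hAeq r).1 h.1)
        rw [if_neg hc, if_neg hA, zero_mul]
    · have hc : ¬(Current.sources (Ψ (k, r)) = A ∆ ({u} ∆ {v}) ∧ Even ((Ψ (k, r)) b)) := by
        rw [hkb]; exact fun h => hk h.2
      rw [if_neg hc, if_neg hk, mul_zero]
  rw [hL, hR, mul_comm (ENNReal.ofReal _) (S * _), mul_assoc, ← ENNReal.ofReal_mul (Real.cosh_pos β).le]
  congr 2
  rw [Real.tanh_eq_sinh_div_cosh, mul_comm, div_mul_cancel₀ _ (Real.cosh_pos β).ne']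

/-! ## The parity of the first pivotal bond and the form (2.13) of the summand -/

/-- Resetting a bond that is not an edge of `G₁` does not change the trace inside `G₁`. [folklore] -/
theorem tracedIn_update_of_notMem {G₁ : SimpleGraph V} (n : Current G) {b : G.edgeFinset}
    (hb : (b : Sym2 V) ∉ G₁.edgeSet) :
    Current.tracedIn G₁ (Function.update n b 0 : Current G) = Current.tracedIn G₁ n := by
  ext f
  simp only [Current.tracedIn, Set.mem_setOf_eq, traced_update_zero, Set.mem_sdiff, Set.mem_singleton_iff]
  constructor
  · rintro ⟨hf, hft, -⟩; exact ⟨hf, hft⟩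
  · rintro ⟨hf, hft⟩; exact ⟨hf, hft, fun h => hb (h ▸ hf)⟩

/-- **The parity lemma** ("since `b` is pivotal … and `∂n = o △ x`, in fact `n_b` is an odd
integer"): handshake on the cluster `𝒞^b_n(o)`, which contains the source `o` but neither `x`
nor any other source. [cite: Sakai2007, §2.2.1 (before (2.12))] -/
theorem odd_of_isFirstPivotal {N : Current G} {o x : V} {d : G.Dart}
    (hs : Current.sources N = ({o} : Finset V) ∆ {x}) (h : IsFirstPivotal G N o x d) :
    Odd (N (dartEdge G d)) := by
  classical
  by_contra hodd
  set b := dartEdge G d with hb_def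
  have hb : ((b : G.edgeFinset) : Sym2 V) = s(d.fst, d.snd) := rfl
  set N₀ : Current G := Function.update N b 0 with hN₀
  have hsrc : Current.sources N₀ = ({o} : Finset V) ∆ {x} := by
    have h1 := sources_eq_symmDiff_update N b hb
    rw [if_neg hodd, ← Finset.bot_eq_empty, symmDiff_bot] at h1
    rw [← h1, hs]
  set C := clusterOff G N b o with hC_def
  have hC : ∀ w, w ∈ C ↔ (Percolation.openGraph N₀.traced).Reachable o w := fun w => by
    rw [hC_def, clusterOff_eq, Current.mem_cluster_iff]
  have heven := Current.even_card_sources_cluster N₀ o C hC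
  have hxC : x ∉ C := (connAvoid_iff.1 h.2.2).2.1
  have hoC : o ∈ C := (hC o).2 (SimpleGraph.Reachable.refl o)
  have hox : o ≠ x := fun h' => hxC (h' ▸ hoC)
  have hfilter : C.filter (fun w => w ∈ Current.sources N₀) = {o} := by
    ext w
    simp only [Finset.mem_filter, hsrc, Finset.mem_symmDiff, Finset.mem_singleton]
    constructor
    · rintro ⟨hwC, hw⟩
      rcases hw with ⟨rfl, -⟩ | ⟨rfl, -⟩
      · rfl
      · exact absurd hwC hxC
    · rintro rfl
      exact ⟨hoC, Or.inl ⟨rfl, hox⟩⟩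
  rw [hfilter, Finset.card_singleton] at heven
  exact Nat.not_even_one heven

/-- On `{∂n = o △ x}` the three indicators of (2.9) amount to "odd current on `b`" times the two
`n_b`-blind indicators. [cite: Sakai2007, (2.12)] -/
theorem isFirstPivotal_iff_odd_and {N : Current G} {o x : V} {d : G.Dart}
    (hs : Current.sources N = ({o} : Finset V) ∆ {x}) :
    IsFirstPivotal G N o x d ↔ Odd (N (dartEdge G d)) ∧
      (IsDoublyConn G (Function.update N (dartEdge G d) 0) o d.fst ∧
        ConnAvoid G N (clusterOff G N (dartEdge G d) o) d.snd x) :=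
  ⟨fun h => ⟨odd_of_isFirstPivotal hs h, h.1, h.2.2⟩, fun h => ⟨h.2.1, h.1.pos, h.2.2⟩⟩

/-- The two `n_b`-blind indicators are indeed blind to `n_b`: resetting `n_b` changes neither the
cluster `𝒞^b_n(o)` nor — when `b̲` lies in it — the connections by bonds off it. [folklore] -/
theorem blind_indicator_update (N : Current G) (o x : V) (d : G.Dart) :
    (IsDoublyConn G (Function.update N (dartEdge G d) 0) o d.fst ∧
        ConnAvoid G N (clusterOff G N (dartEdge G d) o) d.snd x) ↔
      (IsDoublyConn G (Function.update (Function.update N (dartEdge G d) 0) (dartEdge G d) 0) o d.fst ∧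
        ConnAvoid G (Function.update N (dartEdge G d) 0)
          (clusterOff G (Function.update N (dartEdge G d) 0) (dartEdge G d) o) d.snd x) := by
  set b := dartEdge G d
  have hidem : Function.update (Function.update N b 0) b 0 = Function.update N b 0 :=
    Function.update_idem _ _ _
  have hcl : clusterOff G (Function.update N b 0) b o = clusterOff G N b o := by
    rw [clusterOff_eq, clusterOff_eq, hidem]
  rw [hidem, hcl]
  refine and_congr_right fun hdc => ?_
  -- `d.fst ∈ 𝒞^b_N(o)`, so `b` is not a bond off the cluster and the restricted traces agree
  have hfst : d.fst ∈ clusterOff G N b o := by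
    rw [clusterOff_eq, ← conn_iff_mem_cluster]; exact hdc.1
  have hb : ((b : G.edgeFinset) : Sym2 V) ∉ (offGraph G (clusterOff G N b o)).edgeSet := by
    rw [mem_edgeSet_offGraph, show ((b : G.edgeFinset) : Sym2 V) = s(d.fst, d.snd) from rfl,
      Current.edgeOff_mk]
    exact fun h => h.2.1 hfst
  simp only [connAvoid_iff, Current.mem_connIn_iff, tracedIn_update_of_notMem N hb]

open Classical in
/-- **The `b`-summand of (2.11) in the form (2.13)**: for `β ≥ 0` and a directed bond
`b = (b̲, b̄)`,
`Σ_{∂n = o△x} w(n) 1{o ⟺ b̲ off b} 1{n_b > 0} 1{b̄ ⟷ x in 𝒞^b_n(o)ᶜ}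
  = tanh β · Σ_{∂n = o△b△x, n_b even} w(n) 1{o ⟺ b̲ off b} 1{b̄ ⟷ x in 𝒞^b_n(o)ᶜ}`.
[cite: Sakai2007, (2.11)–(2.13)] -/
theorem tsum_isFirstPivotal_eq {β : ℝ} (hβ : 0 ≤ β) (o x : V) (d : G.Dart) :
    ∑' n : Current G, (if Current.sources n = ({o} : Finset V) ∆ {x} ∧ IsFirstPivotal G n o x d then
        ENNReal.ofReal (Current.weight β n) else 0) =
      ENNReal.ofReal (Real.tanh β) * ∑' n : Current G,
        (if Current.sources n = (({o} : Finset V) ∆ {x}) ∆ ({d.fst} ∆ {d.snd}) ∧ Even (n (dartEdge G d)) ∧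
            (IsDoublyConn G (Function.update n (dartEdge G d) 0) o d.fst ∧
              ConnAvoid G n (clusterOff G n (dartEdge G d) o) d.snd x)
          then ENNReal.ofReal (Current.weight β n) else 0) := by
  classical
  set F : Current G → ℝ≥0∞ := fun n =>
    if IsDoublyConn G (Function.update n (dartEdge G d) 0) o d.fst ∧
        ConnAvoid G n (clusterOff G n (dartEdge G d) o) d.snd x then 1 else 0 with hF_def
  have hF : ∀ n : Current G, F n = F (Function.update n (dartEdge G d) 0) := fun n => by
    simp only [hF_def, blind_indicator_update n o x d]
  have h := tsum_odd_eq_tanh_mul_tsum_even hβ (dartEdge G d) (show _ = s(d.fst, d.snd) from rfl)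
    (({o} : Finset V) ∆ {x}) F hF
  -- identify the summands
  have hL : ∀ n : Current G, (if Current.sources n = ({o} : Finset V) ∆ {x} ∧ IsFirstPivotal G n o x d then
      ENNReal.ofReal (Current.weight β n) else 0) =
      (if Current.sources n = ({o} : Finset V) ∆ {x} ∧ Odd (n (dartEdge G d)) then
        ENNReal.ofReal (Current.weight β n) * F n else 0) := by
    intro n
    by_cases hsn : Current.sources n = ({o} : Finset V) ∆ {x}
    · simp only [hsn, true_and, isFirstPivotal_iff_odd_and hsn, hF_def]
      by_cases ho : Odd (n (dartEdge G d))
      · simp only [ho, true_and, if_true]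
        split_ifs <;> simp
      · simp [ho]
    · simp [hsn]
  have hR : ∀ n : Current G, (if Current.sources n = (({o} : Finset V) ∆ {x}) ∆ ({d.fst} ∆ {d.snd}) ∧
        Even (n (dartEdge G d)) ∧
          (IsDoublyConn G (Function.update n (dartEdge G d) 0) o d.fst ∧
            ConnAvoid G n (clusterOff G n (dartEdge G d) o) d.snd x)
        then ENNReal.ofReal (Current.weight β n) else 0) =
      (if Current.sources n = (({o} : Finset V) ∆ {x}) ∆ ({d.fst} ∆ {d.snd}) ∧ Even (n (dartEdge G d)) then
        ENNReal.ofReal (Current.weight β n) * F n else 0) := by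
    intro n
    simp only [hF_def]
    split_ifs <;> simp_all
  rw [tsum_congr hL, h, tsum_congr hR]

end IsingLace

end Literature.Probability.LatticeModels

end
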